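/-
Copyright: the b2b-balaban cell (near-miss cell 7), T⁴-continuum fan-out, lineage t4-ne7b-p1 (node U5c COUNT member).
Released under the licence of the surrounding project.
-/
import Summits.QuantumFields.BalabanUV.T4Continuum.Support.CountWitnessRun

/-!
# The count chain's exit is inhabited, non-vacuously (non-vacuity, part 2)

Summits-side support leaf of the T⁴-continuum cell (rung (B)+1 on a FINITE torus only; NOT infinite volume, NOT the
mass gap, NOT the Clay statement; NOT a proof of the spine estimate NE7b).  Lineage `t4-ne7b-p1` (generation 21),
node U5c.  [folklore] MODEL data over the lineage's OWN typed carrier; nothing is quoted from print, nothing printed is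
asserted, nothing of Bałaban's is constructed; no `[cite:]` tag.

WHAT.  With the run and the genealogy of `Support/CountWitnessRun` (constant coupling at the NAMED infrared threshold,
least admissible window, two births + one merger + renewals at readiness, pending at every cutoff `K ≥ 2`), this leaf
supplies the remaining data of the row's exit `CountThresholdUniform.relWeightBoundZ_of_irThreshold` and DISCHARGES EVERY
BINDER: §1 cells `range 16^a` (`V = 1`, `Λ = 16`), event tables `dictE`∕`dictB` with fatness cap `1`, matching scale
`K∕2` (`c = 1∕2`), budgets `ρ̄ = 1`, `η̄ = 3`, rate `16·e^{3−8} < 1`, `Λ′ = 1`; §2 the labelled price `yw` = the exact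
right-hand side of `hlabZ` on the ONE live slot `⟨0, 0, b₀, QK K⟩` of the witness genealogy (zero elsewhere), its record
∕ live-slot ∕ old-slot memberships; §3 the term families (two terms: a bad one weighing the price, a good one weighing
`1`), the live families `str`, and ONE `Regeneration` structure serving both runs; §4 **`witness_relWeightBound`** = the
exit theorem APPLIED to these data, and **`witness_nonvacuous`**: from some `K₁ ≥ 2` on the produced `RelWeightBound`
has the bad class `{true}` at every `(K, t)` with STRICTLY POSITIVE weight `price K` — the certified inequality
`price K ≤ W K · (price K + 1)` is not `0 ≤ 0`.  So the thirty-odd binders of the exit are JOINTLY SATISFIABLE with a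
merger present and a positively weighted bad class; the statement is neither contradictory nor trivial.

NOT DONE HERE.  Nothing of the walls (ID) G-ne7bp1g9-1, (E2)∕(R1) G-ne7bp1-1: the witness prices are the model's own
right-hand sides, not Bałaban's term weights.  NE7b discharge: no date.

HONEST DEPENDENCY (cell): continuum YM on T⁴ ⇐ BetaPertH ∧ nine spine estimates (0/9 proved); BetaPertH ⇐ (D1) ∧ (D4)
∧ CAP+tail.  This file changes none of it.
-/

open Finset
open Literature.MathematicalPhysics.QuantumFieldTheory.Balaban1983to89
open T4PersistenceDictionary T4PersistentHistoryCount T4BankedInduction T4PrintedShapeBanking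
open T4WeightBudget T4GlobalDenominator T4LiveClassFibration T4LiveStructureGas T4LiveGasToTerms T4RecordPriceSeam
open T4PartnerMultiplicity
open Summit.QuantumFields.BalabanUV.T4Continuum.PlacementBatch
open Summit.QuantumFields.BalabanUV.T4Continuum.PlacementSkeleton
open Summit.QuantumFields.BalabanUV.T4Continuum.Crowding
open Summit.QuantumFields.BalabanUV.T4Continuum.CountThresholdUniform
open Summit.QuantumFields.BalabanUV.T4Continuum.CountWitnessRun

namespace Summit.QuantumFields.BalabanUV.T4Continuum.CountWitness

noncomputable section

/-! ## §1 Cells, tables, matching scale, budgets, rates -/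

/-- the witness cells: `16^a` cells of age `a` (`Λ = 16 = L^4` at `L = 2`) [folklore] -/
def Cellw (_K a : ℕ) : Finset ℕ := range (16 ^ a)

/-- the cell count `#Cell K a ≤ 1·16^a` [folklore] -/
theorem hcell_w (K a : ℕ) : ((Cellw K a).card : ℝ) ≤ 1 * (16 : ℝ) ^ a := by simp [Cellw]

/-- the cell `0` is a cell of every age [folklore] -/
theorem zero_mem_Cellw (K a : ℕ) : 0 ∈ Cellw K a := mem_range.2 (pow_pos (by norm_num) a)

/-- the event tables: all events at steps in `(j, K]`, fatness `< 1` [folklore] -/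
def Ew : ℕ → ℕ → Finset PEv := dictE fun _ => 1
/-- the birth kinds: `(j, 0, 0)` [folklore] -/
def Bw : ℕ → ℕ → Finset PEv := dictB fun _ => 1

/-- table events sit at steps in `(j, K]` [folklore] -/
theorem hE_w (K j : ℕ) : ∀ e ∈ Ew K j, PEv.step e ∈ Ioc j K := dictE_step _ K j

/-- the matching scale `K∕2` is at most `K` [folklore] -/
theorem hj_w (K : ℕ) : K / 2 ≤ K := Nat.div_le_self K 2

/-- half of the steps are old: `K∕2 ≤ K − K∕2` [folklore] -/
theorem hfrac_w (K : ℕ) : (1 / 2 : ℝ) * K ≤ ((K - K / 2 : ℕ) : ℝ) := by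
  have h1 : K / 2 ≤ K := Nat.div_le_self K 2
  have h2 : ((K / 2 : ℕ) : ℝ) ≤ (K : ℝ) / 2 := Nat.cast_div_le
  rw [Nat.cast_sub h1]
  linarith

/-- the model's residuals are at most one: reserves and margins are nonnegative at the witness constants [folklore] -/
theorem rho_le_one_w (b : PEv) : rho Cw (fun _ => gw) b ≤ 1 := by
  rw [rho, Real.exp_le_one_iff, neg_nonpos]
  have h1 : 0 ≤ reserve Cw (fun _ => gw) b := by
    unfold reserve; split_ifs
    · exact mul_nonneg zero_le_two p0Profile_w_nonneg
    · exact le_rfl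
  have h2 : 0 ≤ Emarg Cw b := by
    unfold Emarg; split_ifs
    · simp [Cw]; positivity
    · simp [Cw]
  linarith

/-- … [folklore] -/
theorem eta_le_one_w (e : PEv) : eta Cw e ≤ 1 := by
  rw [eta, Real.exp_le_one_iff, neg_nonpos]
  unfold Emarg; split_ifs
  · simp [Cw]; positivity
  · simp [Cw]

/-- the birth budget `ρ̄ = 1`: one birth kind per slot, residual `≤ 1` [folklore] -/
theorem hρbar_w (K j : ℕ) : ∑ b ∈ Bw K j, rho Cw (fun _ => gw) b ≤ 1 := by
  have hc : (Bw K j).card = 1 := by simp [Bw, dictB]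
  calc ∑ b ∈ Bw K j, rho Cw (fun _ => gw) b ≤ ∑ _b ∈ Bw K j, (1 : ℝ) := sum_le_sum fun b _ => rho_le_one_w b
    _ = 1 := by simp [hc]

/-- the per-step event budget `η̄ = 3`: three kinds of fatness `0` per step, residual `≤ 1` each [folklore] -/
theorem hηbar_w (K j : ℕ) : ∀ t ∈ Ioc j K, ∑ e ∈ Ew K j with PEv.step e = t, eta Cw e ≤ 3 := by
  intro t _
  have hsub : (Ew K j).filter (fun e => PEv.step e = t) ⊆
      ({t} : Finset ℕ) ×ˢ ((Finset.univ : Finset (Fin 3)) ×ˢ Finset.range 1) := by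
    intro e he
    rw [mem_filter] at he
    obtain ⟨he, ht⟩ := he
    have hf := (mem_dictE.1 he).2
    obtain ⟨s, k, d⟩ := e
    simp only [PEv.step_mk, PEv.fat_mk] at ht hf
    simp [ht]; omega
  have hcard : ((Ew K j).filter (fun e => PEv.step e = t)).card ≤ 3 := by
    refine (card_le_card hsub).trans ?_
    simp
  calc ∑ e ∈ Ew K j with PEv.step e = t, eta Cw e ≤ ∑ e ∈ Ew K j with PEv.step e = t, (1 : ℝ) :=
        sum_le_sum fun e _ => eta_le_one_w e
    _ = ((Ew K j).filter (fun e => PEv.step e = t)).card := by simp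
    _ ≤ 3 := by exact_mod_cast hcard

/-- the placement rate: `16·e^{3 − 8} < 1` (`e⁵ ≥ 2⁵ = 32 > 16`) [folklore] -/
theorem hr_w : (16 : ℝ) * Real.exp (3 - Cw.κ₁) < 1 := by
  have two_le_exp_one : (2 : ℝ) ≤ Real.exp 1 := by
    have := Real.add_one_le_exp (1 : ℝ); linarith
  have h5 : (32 : ℝ) ≤ Real.exp 5 := by
    have h : Real.exp 5 = Real.exp 1 ^ 5 := by rw [← Real.exp_nat_mul]; norm_num
    rw [h]
    calc (32 : ℝ) = 2 ^ 5 := by norm_num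
      _ ≤ Real.exp 1 ^ 5 := pow_le_pow_left₀ (by norm_num) two_le_exp_one 5
  have hκ : (3 : ℝ) - Cw.κ₁ = -5 := by simp [Cw]; norm_num
  rw [hκ, Real.exp_neg]
  have hpos : 0 < Real.exp 5 := Real.exp_pos 5
  rw [mul_inv_lt_iff₀ hpos]
  linarith

/-- the partner-position rate with `Λ′ = 1`, `ε = 1`: `e^{1−8} ≤ 1` [folklore] -/
theorem hΛ1_w : (1 : ℝ) * Real.exp 1 * Real.exp (-Cw.κ₁) ≤ 1 := by
  rw [one_mul, ← Real.exp_add, Real.exp_le_one_iff]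
  norm_num [Cw]

/-! ## §2 The labelled price on the one live slot of the witness genealogy -/

/-- the record of the witness genealogy: its events but the root [folklore] -/
def QK (K : ℕ) : Finset PEv := (GK K).events.erase b₀

/-- **THE PRICE** of the witness genealogy at cutoff `K`: the right-hand side of `hlabZ` VERBATIM (`Kz = 1`, `σ = 1∕2`,
`p = 1`, `Λ′ = 1`). [folklore] -/
def price (K : ℕ) : ℝ :=
  (1 : ℝ) ^ (merges (GK K)).card * (∏ e ∈ merges (GK K), Crowding.Q (wcnt (GK K)) (1 / 2) e.step ^ (1 : ℝ)) *
    (1 : ℝ) ^ partnerAges PEv.step (GK K) *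
      (Real.exp (-credits (credit Cw (fun _ => gw)) (GK K)) *
        Real.exp (lifeCost (dictW (fun _ => Rw) Cw.n₁) (cost Cw K (fun _ => Rw)) (GK K)))

/-- the price is strictly positive (the merger's crowding factor is `Q ≥ 1`) [folklore] -/
theorem price_pos (K : ℕ) : 0 < price K := by
  unfold price
  refine mul_pos (mul_pos (mul_pos (by simp) (prod_pos fun e he => ?_)) (by simp)) (by positivity)
  exact Real.rpow_pos_of_pos (lt_of_lt_of_le one_pos (one_le_Qw_of_mem (by norm_num) he)) _

/-- **THE LABELLED PRICE**: the price on the slot `⟨0, 0, b₀, QK K⟩`, zero on every other slot. [folklore] -/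
def yw (K j : ℕ) (z : ℕ) (b : PEv) (Q : Finset PEv) : ℝ :=
  if j = 0 ∧ z = 0 ∧ b = b₀ ∧ Q = QK K then price K else 0

/-- labelled prices are nonnegative [folklore] -/
theorem yw_nonneg (K j z : ℕ) (b : PEv) (Q : Finset PEv) : 0 ≤ yw K j z b Q := by
  unfold yw; split_ifs
  · exact (price_pos K).le
  · exact le_rfl

/-- the price on the witness slot [folklore] -/
theorem yw_self (K : ℕ) : yw K 0 0 b₀ (QK K) = price K := by simp [yw]

/-- the record of the witness genealogy lies in the event table of its slot [folklore] -/
theorem QK_subset {K : ℕ} (hK : 2 ≤ K) : QK K ⊆ Ew K 0 := by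
  intro e he
  rw [QK, mem_erase] at he
  obtain ⟨hs, hf⟩ := mem_events_GK hK he.2 he.1
  exact mem_dictE.2 ⟨hs, by rw [hf]; exact Nat.one_pos⟩

/-- … and is a RECORD of the count (span condition from well-formedness + pendency, `Gen.mem_records`) [folklore] -/
theorem QK_mem_records {K : ℕ} (hK : 2 ≤ K) : QK K ∈ records Ww 0 K (Ew K 0) b₀ := by
  have h := Gen.mem_records (wf_GK K) (lt_reach_GK K) (E := Ew K 0)
    (by rw [root_GK]; exact QK_subset hK)
  rwa [root_GK, rootStep_GK] at h

/-- the root birth is a birth kind of its slot [folklore] -/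
theorem b₀_mem_Bw (K : ℕ) : b₀ ∈ Bw K 0 := mem_dictB.2 ⟨rfl, rfl, Nat.one_pos⟩

/-- **THE WITNESS SLOT** `⟨0, 0, b₀, QK K⟩` [folklore] -/
def slotK (K : ℕ) : Slot ℕ PEv := ⟨0, 0, b₀, QK K⟩

/-- it is a LIVE slot [folklore] -/
theorem slotK_mem_liveSlots {K : ℕ} (hK : 2 ≤ K) : slotK K ∈ liveSlots Cellw Ww Ew Bw K := by
  simp only [liveSlots, slotK, mem_sigma, mem_range]
  exact ⟨Nat.succ_pos K, zero_mem_Cellw K _, b₀_mem_Bw K, QK_mem_records hK⟩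

/-- it is an OLD slot (born at `0 < K∕2`) [folklore] -/
theorem slotK_mem_oldSlots {K : ℕ} (hK : 2 ≤ K) : slotK K ∈ oldSlots Cellw Ww Ew Bw (fun K => K / 2) K := by
  simp only [oldSlots, slotK, mem_sigma, mem_range]
  exact ⟨by omega, zero_mem_Cellw K _, b₀_mem_Bw K, QK_mem_records hK⟩

/-- **THE LABELLING BINDER `hlabZ` HOLDS**: on the witness slot the witness genealogy is consistent, well formed, born at
`0`, pending at `K`, rooted at `b₀`, with record `QK K`, and the price IS the right-hand side; elsewhere the price is
`0`. [folklore] -/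
theorem hlabZ_w (K : ℕ) (hK : 2 ≤ K) (j : ℕ) (_hj : j ≤ K) (z : ℕ) (_hz : z ∈ Cellw K (K - j)) (b : PEv)
    (_hb : b ∈ Bw K j) (Q : Finset PEv) (_hQ : Q ∈ records (dictW (fun _ => Rw) Cw.n₁) j K (Ew K j) b) :
    yw K j z b Q ≤ 0 ∨ ∃ G : Gen PEv, Consistent Cw K (fun _ => Rw) G ∧ G.WF (dictW (fun _ => Rw) Cw.n₁) ∧
      G.rootStep = j ∧ K < G.reach (dictW (fun _ => Rw) Cw.n₁) ∧ G.root = b ∧ G.events.erase G.root = Q ∧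
      yw K j z b Q ≤ (1 : ℝ) ^ (merges G).card * (∏ e ∈ merges G, Crowding.Q (wcnt G) (1 / 2) e.step ^ (1 : ℝ)) *
        (1 : ℝ) ^ partnerAges PEv.step G * (Real.exp (-credits (credit Cw (fun _ => gw)) G) *
          Real.exp (lifeCost (dictW (fun _ => Rw) Cw.n₁) (cost Cw K (fun _ => Rw)) G)) := by
  by_cases h : j = 0 ∧ z = 0 ∧ b = b₀ ∧ Q = QK K
  · obtain ⟨rfl, rfl, rfl, rfl⟩ := h
    refine Or.inr ⟨GK K, consistent_GK hK, wf_GK K, rootStep_GK K, lt_reach_GK K, root_GK K, by rw [root_GK]; rfl, ?_⟩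
    rw [yw_self]; exact le_of_eq rfl
  · exact Or.inl (by simp [yw, h])

/-! ## §3 Term families, live families, the regeneration structure -/

/-- **THE TERM FAMILIES** (both runs alike): two terms per cutoff — the bad term `true` weighing `price K`, the good term
`false` weighing `1`. [folklore] -/
def termA (K : ℕ) (_t : ℝ) (τ : Bool) : ℝ := if τ then price K else 1

/-- the live price of a class [folklore] -/
def Fw (K : ℕ) (c : Bool) : ℝ := if c then price K else 0

/-- the live family of a class: the witness slot [folklore] -/
def strw (K : ℕ) (_c : Bool) : Finset (Slot ℕ PEv) := {slotK K}

/-- the terms: both [folklore] -/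
def Tw (_K : ℕ) : Finset Bool := univ
/-- the class map: a term is its own class [folklore] -/
def πw (_K : ℕ) : Bool → Bool := id
/-- the class-level bad set: the class `true` [folklore] -/
def Badw (_K : ℕ) (_t : ℝ) : Finset Bool := {true}

/-- fibres are singletons [folklore] -/
theorem fibre_w (K : ℕ) (c : Bool) : fibre πw Tw K c = {c} := by
  ext τ; simp [fibre, πw, Tw]

/-- the term sum is `price K + 1` [folklore] -/
theorem sum_termA (K : ℕ) (t : ℝ) : ∑ τ ∈ Tw K, termA K t τ = price K + 1 := by
  simp [Tw, termA]

/-- **THE REGENERATION STRUCTURE** of the witness term family (dead-past factor `1`, resummation `1`, envelopes `1`,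
constant `1`, from `K₀ = 2`): every field is an identity or `price K ≥ 0`. [folklore] -/
theorem regen_w : Regeneration 1 πw Tw termA Badw (fun _ _ _ => 1) Fw (fun _ _ => 1) (fun _ _ => 1) (fun _ _ => 1) 1 2
    where
  bad_subset K t _ _ := by simp [Badw, classIndex, Tw, πw]
  low K t _ _ := by rw [sum_termA]; linarith [price_pos K]
  up K t _ _ c hc τ hτ := by
    simp only [Badw, mem_singleton] at hc; subst hc
    rw [fibre_w, mem_singleton] at hτ; subst hτ
    simp [termA, Fw]
  dead_nonneg K t _ _ c _ τ _ := zero_le_one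
  resum K t _ _ c hc := by rw [fibre_w]; simp
  F_nonneg K t _ _ c _ := by unfold Fw; split_ifs <;> [exact (price_pos K).le; exact le_rfl]
  nup_nonneg K t _ _ := zero_le_one
  ratio K t _ _ := by norm_num

/-- the live families are injective on the bad classes (a singleton) [folklore] -/
theorem hinj_w (K : ℕ) (t : ℝ) (_ht : |t| ≤ 1) (_hK : 2 ≤ K) : Set.InjOn (strw K) (Badw K t : Set Bool) := by
  simp [Badw]

/-- the live family of the bad class consists of live slots and contains an old slot [folklore] -/
theorem hstr_w (K : ℕ) (t : ℝ) (_ht : |t| ≤ 1) (hK : 2 ≤ K) :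
    ∀ c ∈ Badw K t, strw K c ⊆ liveSlots Cellw (dictW (fun _ => Rw) Cw.n₁) Ew Bw K ∧
      ∃ o ∈ oldSlots Cellw (dictW (fun _ => Rw) Cw.n₁) Ew Bw (fun K => K / 2) K, o ∈ strw K c := by
  intro c _
  refine ⟨fun s hs => ?_, ⟨slotK K, slotK_mem_oldSlots hK, mem_singleton_self _⟩⟩
  rw [strw, mem_singleton] at hs; subst hs
  exact slotK_mem_liveSlots hK

/-- the domination `F·Rf ≤ famWeight (slotPrice y) str` on the bad class: `price K · 1 = y(slot)` [folklore] -/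
theorem hF_w (K : ℕ) (t : ℝ) (_ht : |t| ≤ 1) (_hK : 2 ≤ K) :
    ∀ c ∈ Badw K t, Fw K c * 1 ≤ famWeight (slotPrice (yw K)) (strw K c) := by
  intro c hc
  simp only [Badw, mem_singleton] at hc; subst hc
  simp [Fw, strw, famWeight, slotK, slotPrice, yw_self]

/-! ## §4 The exit theorem APPLIED: the witness `RelWeightBound`, and its non-vacuity -/

/-- the weight produced by the chain for the witness data [folklore] -/
def Wbud (K₁ : ℕ) : ℕ → ℝ :=
  Set.indicator {K | K₁ ≤ K} fun K => 1 * recordsBudget 1 Cw.κ₁ 1 16 3 (fun K => K / 2) K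

/-- the bad class produced by the chain for the witness data [folklore] -/
def BadT (K₁ : ℕ) (K : ℕ) (t : ℝ) : Finset Bool := if K₁ ≤ K then badOfClass πw Tw Badw K t else ∅

/-- **THE ROW'S EXIT, INHABITED**: `CountThresholdUniform.relWeightBoundZ_of_irThreshold` applied to the witness data —
every one of its binders discharged by the lemmas of `Support/CountWitnessRun` and §§1–3. [folklore] -/
theorem witness_relWeightBound : ∃ K₁, 2 ≤ K₁ ∧ RelWeightBound 1 Tw termA termA (BadT K₁) (Wbud K₁) :=
  relWeightBoundZ_of_irThreshold thresholdOK_w (Kz := 1) (p := 1) (σ := 1 / 2) (ε := 1) (θ := 1) le_rfl zero_le_one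
    (by norm_num) (by norm_num) one_pos one_pos Cellw zero_le_one (by norm_num) hcell_w Ew Bw hE_w (fun K => K / 2) hj_w
    (c := 1 / 2) (by norm_num) hfrac_w regen_w regen_w zero_le_one (fun _ _ => Rw) (fun _ _ => gw) (fun _ => 0)
    (fun K _ => flowIneq27_w Cw.p₀ K) (fun K _ => flowIneq29_w K) (fun _ _ _ _ => isRj_w) (fun _ _ _ _ => one_le_log_gw)
    (fun _ _ => ir_w) hρbar_w hηbar_w hr_w zero_le_one hΛ1_w yw (fun K j _ z _ b _ Q _ => yw_nonneg K j z b Q)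
    (fun K hK j hj z hz b hb Q hQ => hlabZ_w K hK j hj z hz b hb Q hQ) strw hinj_w hstr_w hF_w hF_w

/-- from `K₁` on the produced bad class is `{true}` [folklore] -/
theorem badT_eq {K₁ K : ℕ} (h : K₁ ≤ K) (t : ℝ) : BadT K₁ K t = {true} := by
  rw [BadT, if_pos h]; ext τ; simp [badOfClass, Tw, πw, Badw]

/-- the bad term carries the strictly positive weight `price K` [folklore] -/
theorem termA_true (K : ℕ) (t : ℝ) : termA K t true = price K := by simp [termA]

/-- **NON-VACUITY**: from some `K₁ ≥ 2` on, a `RelWeightBound` holds whose bad class at EVERY `(K, t)`, `K ≥ K₁`, is the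
non-empty `{true}` with weight `price K > 0` against the total `price K + 1` — the certified inequality
`price K ≤ W K · (price K + 1)` with `W K < 1`, `Σ W < ∞` is NOT `0 ≤ 0`. [folklore] -/
theorem witness_nonvacuous : ∃ (K₁ : ℕ) (W : ℕ → ℝ), 2 ≤ K₁ ∧ RelWeightBound 1 Tw termA termA (BadT K₁) W ∧
    ∀ K, K₁ ≤ K → ∀ t : ℝ, |t| ≤ 1 →
      BadT K₁ K t = {true} ∧ 0 < price K ∧ ∑ τ ∈ BadT K₁ K t, termA K t τ = price K ∧
        price K ≤ W K * (price K + 1) ∧ W K < 1 := by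
  obtain ⟨K₁, hK₁, hW⟩ := witness_relWeightBound
  refine ⟨K₁, Wbud K₁, hK₁, hW, fun K hK t ht => ?_⟩
  have hb := badT_eq hK t
  have hsum : ∑ τ ∈ BadT K₁ K t, termA K t τ = price K := by rw [hb]; simp [termA]
  refine ⟨hb, price_pos K, hsum, ?_, hW.lt_one K⟩
  have h := hW.bad_left K t ht
  rwa [hsum, sum_termA] at h

/-! ## §5 Sanity -/

namespace Sanity

/-- the witness genealogy carries exactly one merger and two births at every cutoff [folklore] -/
example (K : ℕ) : (merges (GK K)).card = 1 ∧ (births (GK K)).card = 2 := by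
  rw [merges_GK, births_GK]; simp [b₀, b₁]

/-- the witness slot price is the price [folklore] -/
example (K : ℕ) : slotPrice (yw K) (slotK K) = price K := by simp [slotK, slotPrice, yw_self]

end Sanity

end

end Summit.QuantumFields.BalabanUV.T4Continuum.CountWitness
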